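import Literature.AlgebraicGeometry.Motives.HodgeStructurePolarizationAutGroup
import Literature.AlgebraicGeometry.Motives.MumfordTateGroupDual
import Literature.AlgebraicGeometry.Motives.HodgeStructureTensorPolarization
import Literature.AlgebraicGeometry.Motives.HodgeStructureAbelianTypeDual
import HarnessLib

/-!
# The endomorphism algebra and the automorphism groups of the DUAL Hodge structure under the contragredient `g ↦ (g⁻¹)ᵀ`: `E_φ(H^∨) = ᵗE_φ(H)`,
# `Aut(H^∨, φ) = Aut(H, φ)ᶜ`, `G_{Q^∨}(ℚ) = G_Q(ℚ)ᶜ`, `Aut(H^∨, Q^∨, φ) = Aut(H, Q, φ)ᶜ` (Moonen 1999 (1.8) «`MT(V^*)` is isomorphic to `MT(V)` under `g ↦ (g^*)⁻¹`»,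
# Deligne–Milne (1.6.6) the transpose; Green–Griffiths–Kerr §I.A `G = Aut(V, Q)`)

[topic AlgebraicGeometry/Motives]

Layer `Literature/AlgebraicGeometry/Motives`, lane `lit-hodgefound` (Track 2 foundations library; seat `lit-hodgefound-p02`, gen 45, row g45-#5; the g44 FINAL pointer (α)).
FOUR DEFINITIONS WITH BODIES (two restricted contragredient homomorphisms and the two `MulEquiv`s transporting `Aut(H, φ)` and `Aut(H, Q, φ)` to the dual) and THEOREMS; no named fact (D-0026 net debt `0`), no instance,
no notation. The tree has the dual Hodge structure `H.dual` (`Motives/HodgeTensor`), the transpose of a morphism `Hom.dualMap` (`Motives/HodgeStructureAbelianTypeDual`),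
the dual polarization `Q.dual` with form `Q^∨(φ, χ) = Q(θ⁻¹φ, θ⁻¹χ)` (`Motives/HodgeStructureTensorPolarization`, `Motives/MumfordTateInvariantsDualForm`:
`dualForm_comp_symm`), and p34's `Motives/MumfordTateGroupDual`: the contragredient `contragredientOver δ`, `g ↦ (g⁻¹)ᵀ` along `δ = id_{V^∨}`
(`contragredientOver_refl_apply`), with `MT(H^∨)(ℚ) = MT(H)(ℚ)ᶜ` (`symm_dualMap_mem_mumfordTateGroup_dual_iff`, `mumfordTateGroup_dual_eq`) and the same for `Hg`.
This file adds the ENDOMORPHISM ALGEBRA and the AUTOMORPHISM GROUPS of g44-#1 (`H.autGroup = Aut(V, φ)`, `Q.isometryGroup = G(ℚ)`, `Q.autGroup = Aut(V, Q, φ)`).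

## Sources, verbatim

* B. Moonen, *Notes on Mumford–Tate groups* (1999) [Moonen1999MTNotes], (1.8) Remark (materialised `paper:url-c4d52097ebb3` p. 4 L20–L28): «Let `T` be a tensor
  construction as in (1.5). Write `r : GL(V) → GL(T)` for the canonical homomorphism. Then `MT(T)` equals the image of `MT(V)` under `r`. […] As examples of
  this principle, we find that `MT(V^∗)` is isomorphic to `MT(V)` (under the natural isomorphism `g ↦ (g^∗)⁻¹`).»
* P. Deligne, J. S. Milne, *Tannakian categories* (LNM 900, II) [DeligneMilne1982Tannakian], §1 (1.6.6): the transpose `ᵗf : Y^∨ → X^∨` of `f : X → Y` in a rigid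
  tensor category (the tree's `Hom.dualMap`); B. Moonen, *Families of motives and the Mumford–Tate conjecture* [Moonen2017FamiliesMotives], §2.1 (p. 3): in `HS_ℚ`
  «we have […] duals; on the underlying `ℚ`-vector spaces they are given by the usual constructions».
* M. Green, P. Griffiths, M. Kerr, *Mumford–Tate Groups and Domains* [GreenGriffithsKerr2012], §I.A (PDF p. 34 L41): «We shall denote by `G = Aut(V, Q)` the
  `ℚ`-algebraic group associated to `(V, Q)`»; (V.2) proof (PDF p. 152 L5): «`E*` is just the `ℚ`-points of the centralizer `Z := Z_{G̃}(M)`».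

## Dictionary and mechanism

`(g⁻¹)ᵀ = g.symm.dualMap = contragredientOver (LinearEquiv.refl ℚ V^∨) g`. ENDOMORPHISMS: `a ∈ E_φ(H) ⟹ aᵀ ∈ E_φ(H^∨)` is the tree's `Hom.dualMap`; conversely
`E_φ = End(V)^{MT(ℚ)}` (`mem_endAlg_iff_forall_mumfordTateGroup`, GGK (V.2)) and `MT(H^∨)(ℚ) = MT(H)(ℚ)ᶜ`, and `aᵀ` commutes with `(g⁻¹)ᵀ` iff `a` commutes with
`g⁻¹` (`ᵀ` is injective and anti-multiplicative) — `dualMap_mem_endAlg_dual_iff`. AUTOMORPHISMS: `Aut(V, φ) = {g | ↑g ∈ E_φ}` and `↑((g⁻¹)ᵀ) = (↑g⁻¹)ᵀ`.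
ISOMETRIES: `θ = Q♭ : V ⥲ V^∨` and `Q^∨(φ, χ) = Q(θ⁻¹φ, θ⁻¹χ)`; for `g ∈ G_Q(ℚ)`, `Q^∨(φ ∘ g⁻¹, χ ∘ g⁻¹) = Q^∨(φ, χ)` is the tree's `dualForm_comp_symm` with multiplier `1`;
conversely `(g⁻¹)ᵀ θ = θ (g⁻¹)†` (`†` the `Q`-adjoint: `Q((g⁻¹)† v, x) = Q(v, g⁻¹ x)`), so `(g⁻¹)ᵀ ∈ G_{Q^∨}(ℚ)` makes `(g⁻¹)†` a `Q`-isometry, whence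
`(g⁻¹)†† (g⁻¹)† = g⁻¹ (g⁻¹)† = 1`, `(g⁻¹)† = g`, `g† = g⁻¹`, `g ∈ G_Q(ℚ)` — `symm_dualMap_mem_isometryGroup_dual_iff`.

## What is defined / proved (`V` finite-dimensional, `H : HodgeStructure V n`, `Q : Polarization H`, `[HodgeTensorFacts]` for `H.dual`)

* §1 `dualMap_eq_dualMap_iff` (`ᵀ` is injective on `End(V)`), `dualMap_mem_endAlg_dual` (`Hom.dualMap`), `mem_endAlg_of_dualMap_mem`, **`dualMap_mem_endAlg_dual_iff`** (`E_φ(H^∨) = ᵗE_φ(H)`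
  elementwise), `coe_symm_dualMap` (`↑((g⁻¹)ᵀ) = (↑g⁻¹)ᵀ`).
* §2 **`symm_dualMap_mem_autGroup_dual_iff`** (`(g⁻¹)ᵀ ∈ Aut(H^∨, φ) ⟺ g ∈ Aut(H, φ)`), **`autGroup_dual_eq`** (`Aut(H^∨, φ) = Aut(H, φ)ᶜ` as the image under the tree's
  `contragredientOver`), `contragredientOver_refl_injective`, DEF `autGroup.contragredientHom` (+ `coe_…_apply`, `…_bijective`), DEF **`autGroupDualMulEquiv :
  H.autGroup ≃* H.dual.autGroup`** (+ `coe_autGroupDualMulEquiv_apply`).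
* §3 `toDualEquiv_adjoint_symm_apply` (`θ ((g⁻¹)† v) = (g⁻¹)ᵀ (θ v)`), `dualForm_toDualEquiv` (`Q^∨(θ v, θ w) = Q(v, w)`), `symm_dualMap_mem_isometryGroup_dual`
  (multiplier-`1` case of `dualForm_comp_symm`), `mem_isometryGroup_of_symm_dualMap_mem`, **`symm_dualMap_mem_isometryGroup_dual_iff`** (`G_{Q^∨}(ℚ) = G_Q(ℚ)ᶜ`),
  `isometryGroup_dual_eq`, **`symm_dualMap_mem_polarizationAutGroup_dual_iff`**, **`polarizationAutGroup_dual_eq`** (`Aut(H^∨, Q^∨, φ) = Aut(H, Q, φ)ᶜ`),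
  DEF `Polarization.autGroupContragredientHom` (+ `coe_…_apply`, `…_bijective`), DEF **`Polarization.autGroupDualMulEquiv : Q.autGroup ≃* Q.dual.autGroup`**
  (+ `Polarization.coe_autGroupDualMulEquiv_apply`).

## References

* [Moonen1999MTNotes] B. Moonen, *Notes on Mumford–Tate groups*, Centre Émile Borel (1999): (1.8) Remark (p. 4).
* [DeligneMilne1982Tannakian] P. Deligne, J. S. Milne, *Tannakian categories*, LNM 900 (1982): (1.6.6).
* [Moonen2017FamiliesMotives] B. Moonen, *Families of motives and the Mumford–Tate conjecture*, Milan J. Math. 85 (2017): §2.1 (p. 3).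
* [GreenGriffithsKerr2012] M. Green, P. Griffiths, M. Kerr, *Mumford–Tate Groups and Domains*, Ann. of Math. Stud. 183 (2012): §I.A (p. 34), (V.2) (p. 152).
-/

noncomputable section

open Module
open scoped TensorProduct

namespace Literature.AlgebraicGeometry.Motives

namespace HodgeStructure

universe u

variable {V : Type u} [AddCommGroup V] [Module ℚ V] [Module.Finite ℚ V] [HodgeTensorFacts.{u, u}] {n : ℤ} {H : HodgeStructure V n}

/-! ## §1 `E_φ(H^∨) = ᵗE_φ(H)` -/

omit [Module.Finite ℚ V] [HodgeTensorFacts.{u, u}] in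
/-- **The transpose is injective on `End(V)`**: `aᵀ = bᵀ ⟺ a = b` (the dual of a vector space separates points). [cite: DeligneMilne1982Tannakian, §1 (1.6.6)–(1.6.7)] -/
theorem dualMap_eq_dualMap_iff {a b : Module.End ℚ V} : a.dualMap = b.dualMap ↔ a = b := by
  refine ⟨fun h ↦ LinearMap.ext fun v ↦ ?_, fun h ↦ by rw [h]⟩
  rw [← sub_eq_zero, ← Module.forall_dual_apply_eq_zero_iff ℚ (a v - b v)]
  intro φ
  have h1 := LinearMap.congr_fun (LinearMap.congr_fun h φ) v
  rw [LinearMap.dualMap_apply, LinearMap.dualMap_apply] at h1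
  rw [map_sub, h1, sub_self]

/-- **`a ∈ E_φ(H) ⟹ aᵀ ∈ E_φ(H^∨)`** (the transpose of a morphism of Hodge structures is a morphism: the tree's `Hom.dualMap`).
[cite: DeligneMilne1982Tannakian, §1 (1.6.6)] [cite: Moonen2017FamiliesMotives, §2.1 (p. 3)] -/
theorem dualMap_mem_endAlg_dual {a : Module.End ℚ V} (ha : a ∈ H.endAlg) : a.dualMap ∈ H.dual.endAlg :=
  (endAlg.toHom ⟨a, ha⟩).dualMap.toLinearMap_mem_endAlg

omit [Module.Finite ℚ V] [HodgeTensorFacts.{u, u}] in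
/-- `↑((g⁻¹)ᵀ) = (↑g⁻¹)ᵀ` in `End(V^∨)` (plumbing). [cite: Moonen1999MTNotes, (1.8)] -/
theorem coe_symm_dualMap (g : V ≃ₗ[ℚ] V) :
    ((g.symm.dualMap : Module.Dual ℚ V ≃ₗ[ℚ] Module.Dual ℚ V) : Module.End ℚ (Module.Dual ℚ V)) = ((g⁻¹ : V ≃ₗ[ℚ] V) : Module.End ℚ V).dualMap :=
  rfl

/-- **`aᵀ ∈ E_φ(H^∨) ⟹ a ∈ E_φ(H)`**: `E_φ(H) = End(V)^{MT(H)(ℚ)}` (GGK (V.2)), `MT(H^∨)(ℚ) ∋ (g⁻¹)ᵀ` for `g ∈ MT(H)(ℚ)` (Moonen (1.8)), and `aᵀ (g⁻¹)ᵀ = (g⁻¹)ᵀ aᵀ`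
forces `g⁻¹ a = a g⁻¹`. [cite: Moonen1999MTNotes, (1.8)] [cite: GreenGriffithsKerr2012, (V.2) proof (PDF p. 152)] -/
theorem mem_endAlg_of_dualMap_mem {a : Module.End ℚ V} (ha : a.dualMap ∈ H.dual.endAlg) : a ∈ H.endAlg := by
  rw [mem_endAlg_iff_forall_mumfordTateGroup]
  intro g hg
  have hg' : (g⁻¹ : V ≃ₗ[ℚ] V) ∈ H.mumfordTateGroup := H.mumfordTateGroup.inv_mem hg
  have h1 := (mem_endAlg_iff_forall_mumfordTateGroup H.dual a.dualMap).1 ha _ (symm_dualMap_mem_mumfordTateGroup_dual hg')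
  -- `(g⁻¹)⁻¹ᵀ = gᵀ`, so `h1 : aᵀ ∘ gᵀ = gᵀ ∘ aᵀ`, i.e. `(g ∘ a)ᵀ = (a ∘ g)ᵀ`
  have h2 : (((g⁻¹ : V ≃ₗ[ℚ] V).symm.dualMap : Module.Dual ℚ V ≃ₗ[ℚ] Module.Dual ℚ V) : Module.Dual ℚ V →ₗ[ℚ] Module.Dual ℚ V) =
      (g : Module.End ℚ V).dualMap := rfl
  rw [h2, LinearMap.dualMap_comp_dualMap, LinearMap.dualMap_comp_dualMap] at h1
  exact (dualMap_eq_dualMap_iff.1 h1).symm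

/-- **`E_φ(H^∨) = ᵗE_φ(H)`, elementwise: `aᵀ ∈ E_φ(H^∨) ⟺ a ∈ E_φ(H)`.** [cite: Moonen1999MTNotes, (1.8)] [cite: DeligneMilne1982Tannakian, §1 (1.6.6)] -/
theorem dualMap_mem_endAlg_dual_iff (a : Module.End ℚ V) : a.dualMap ∈ H.dual.endAlg ↔ a ∈ H.endAlg :=
  ⟨mem_endAlg_of_dualMap_mem, dualMap_mem_endAlg_dual⟩

/-! ## §2 `Aut(H^∨, φ) = Aut(H, φ)ᶜ` under `g ↦ (g⁻¹)ᵀ` -/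

/-- **`(g⁻¹)ᵀ ∈ Aut(H^∨, φ) ⟺ g ∈ Aut(H, φ)`** (Moonen's `g ↦ (g^*)⁻¹` on the automorphism groups `Aut = E_φ^×`). [cite: Moonen1999MTNotes, (1.8)]
[cite: GreenGriffithsKerr2012, (V.2) proof (PDF p. 152)] -/
theorem symm_dualMap_mem_autGroup_dual_iff (g : V ≃ₗ[ℚ] V) : g.symm.dualMap ∈ H.dual.autGroup ↔ g ∈ H.autGroup := by
  rw [mem_autGroup_iff, coe_symm_dualMap, dualMap_mem_endAlg_dual_iff, ← mem_autGroup_iff, inv_mem_iff]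

/-- **`Aut(H^∨, φ)(ℚ)` is the image of `Aut(H, φ)(ℚ)` under the contragredient `g ↦ (g⁻¹)ᵀ`** (the tree's `contragredientOver (LinearEquiv.refl ℚ V^∨)`).
[cite: Moonen1999MTNotes, (1.8)] -/
theorem autGroup_dual_eq : H.dual.autGroup = H.autGroup.map (contragredientOver (LinearEquiv.refl ℚ (Module.Dual ℚ V))) := by
  ext g'
  constructor
  · intro hg'
    obtain ⟨g, rfl⟩ := contragredientOver_surjective (LinearEquiv.refl ℚ (Module.Dual ℚ V)) g'
    rw [contragredientOver_refl_apply] at hg'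
    exact ⟨g, (symm_dualMap_mem_autGroup_dual_iff g).1 hg', rfl⟩
  · rintro ⟨g, hg, rfl⟩
    rw [contragredientOver_refl_apply]
    exact (symm_dualMap_mem_autGroup_dual_iff g).2 hg

omit [Module.Finite ℚ V] [HodgeTensorFacts.{u, u}] in
/-- **The contragredient `g ↦ (g⁻¹)ᵀ` is injective on `GL(V)`.** [cite: Moonen1999MTNotes, (1.8)] -/
theorem contragredientOver_refl_injective : Function.Injective (contragredientOver (LinearEquiv.refl ℚ (Module.Dual ℚ V))) := by
  intro g g' h
  rw [contragredientOver_refl_apply, contragredientOver_refl_apply] at h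
  have h1 : ((g⁻¹ : V ≃ₗ[ℚ] V) : Module.End ℚ V).dualMap = ((g'⁻¹ : V ≃ₗ[ℚ] V) : Module.End ℚ V).dualMap := by
    rw [← coe_symm_dualMap, ← coe_symm_dualMap, h]
  exact inv_injective (LinearEquiv.toLinearMap_injective (dualMap_eq_dualMap_iff.1 h1))

/-- The contragredient restricted to `Aut(H, φ) →* Aut(H^∨, φ)`. [cite: Moonen1999MTNotes, (1.8)] -/
def autGroup.contragredientHom : H.autGroup →* H.dual.autGroup where
  toFun g := ⟨contragredientOver (LinearEquiv.refl ℚ (Module.Dual ℚ V)) g.1, by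
    rw [contragredientOver_refl_apply]
    exact (symm_dualMap_mem_autGroup_dual_iff g.1).2 g.2⟩
  map_one' := Subtype.ext (map_one _)
  map_mul' _ _ := Subtype.ext (map_mul _ _ _)

/-- `Aut(H, φ) →* Aut(H^∨, φ)` is `g ↦ (g⁻¹)ᵀ`. [cite: Moonen1999MTNotes, (1.8)] -/
@[simp]
theorem autGroup.coe_contragredientHom_apply (g : H.autGroup) :
    ((autGroup.contragredientHom g : H.dual.autGroup) : Module.Dual ℚ V ≃ₗ[ℚ] Module.Dual ℚ V) = g.1.symm.dualMap :=
  contragredientOver_refl_apply g.1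

/-- `Aut(H, φ) →* Aut(H^∨, φ)` is bijective. [cite: Moonen1999MTNotes, (1.8)] -/
theorem autGroup.contragredientHom_bijective : Function.Bijective (autGroup.contragredientHom (H := H)) := by
  refine ⟨fun g g' h ↦ Subtype.ext (contragredientOver_refl_injective (congrArg Subtype.val h)), ?_⟩
  rintro ⟨g', hg'⟩
  obtain ⟨g, rfl⟩ := contragredientOver_surjective (LinearEquiv.refl ℚ (Module.Dual ℚ V)) g'
  rw [contragredientOver_refl_apply] at hg'
  exact ⟨⟨g, (symm_dualMap_mem_autGroup_dual_iff g).1 hg'⟩, rfl⟩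

variable (H) in
/-- **`Aut(H, φ) ≅ Aut(H^∨, φ)`, `g ↦ (g⁻¹)ᵀ`**, as a group isomorphism («`MT(V^*)` is isomorphic to `MT(V)` under `g ↦ (g^*)⁻¹`», on `Aut = Z_{GL}(MT) = E_φ^×`).
[cite: Moonen1999MTNotes, (1.8)] [cite: GreenGriffithsKerr2012, (V.2) proof (PDF p. 152)] -/
def autGroupDualMulEquiv : H.autGroup ≃* H.dual.autGroup :=
  MulEquiv.ofBijective autGroup.contragredientHom autGroup.contragredientHom_bijective

/-- `autGroupDualMulEquiv g = (g⁻¹)ᵀ`. [cite: Moonen1999MTNotes, (1.8)] -/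
@[simp]
theorem coe_autGroupDualMulEquiv_apply (g : H.autGroup) :
    ((autGroupDualMulEquiv H g : H.dual.autGroup) : Module.Dual ℚ V ≃ₗ[ℚ] Module.Dual ℚ V) = g.1.symm.dualMap :=
  contragredientOver_refl_apply g.1

/-! ## §3 Isometries and Hodge isometries: `G_{Q^∨}(ℚ) = G_Q(ℚ)ᶜ`, `Aut(H^∨, Q^∨, φ) = Aut(H, Q, φ)ᶜ` -/

section Isometry

variable (ψ : Polarization H)

omit [Module.Finite ℚ V] [HodgeTensorFacts.{u, u}] in
/-- `↑g * ↑g⁻¹ = 1` in `End(V)` (plumbing). [folklore] -/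
private theorem coe_mul_coe_inv₄₅ (g : V ≃ₗ[ℚ] V) : (g : Module.End ℚ V) * ((g⁻¹ : V ≃ₗ[ℚ] V) : Module.End ℚ V) = 1 := by
  rw [← LinearEquiv.coe_toLinearMap_mul, mul_inv_cancel]
  rfl

omit [Module.Finite ℚ V] [HodgeTensorFacts.{u, u}] in
/-- `↑g⁻¹ * ↑g = 1` in `End(V)` (plumbing). [folklore] -/
private theorem coe_inv_mul_coe₄₅ (g : V ≃ₗ[ℚ] V) : ((g⁻¹ : V ≃ₗ[ℚ] V) : Module.End ℚ V) * (g : Module.End ℚ V) = 1 := by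
  rw [← LinearEquiv.coe_toLinearMap_mul, inv_mul_cancel]
  rfl

omit [HodgeTensorFacts.{u, u}] in
/-- **`θ ∘ (g⁻¹)† = (g⁻¹)ᵀ ∘ θ`** for `θ = Q♭ : V ⥲ V^∨` (`θ v = Q(v, ·)`) and the `Q`-adjoint `†`: `Q((g⁻¹)† v, x) = Q(v, g⁻¹ x)`.
[cite: DeligneMilne1982Tannakian, §1 (1.6.6)] -/
theorem toDualEquiv_adjoint_inv_apply (g : V ≃ₗ[ℚ] V) (v : V) :
    ψ.toDualEquiv (ψ.adjoint ((g⁻¹ : V ≃ₗ[ℚ] V) : Module.End ℚ V) v) = g.symm.dualMap (ψ.toDualEquiv v) := by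
  refine LinearMap.ext fun x ↦ ?_
  rw [ψ.toDualEquiv_apply, LinearEquiv.dualMap_apply, ψ.toDualEquiv_apply, ← ψ.form_apply_adjoint, ψ.adjoint_adjoint]
  rfl

/-- **`Q^∨(θ v, θ w) = Q(v, w)`**: `θ` is an isometry `(V, Q) ⥲ (V^∨, Q^∨)`. [cite: Moonen2017FamiliesMotives, §2.1 (p. 3)] -/
theorem dual_form_toDualEquiv (v w : V) : ψ.dual.form (ψ.toDualEquiv v) (ψ.toDualEquiv w) = ψ.form v w := by
  rw [Polarization.dual_form, Polarization.dualForm_apply, LinearEquiv.symm_apply_apply, LinearEquiv.symm_apply_apply]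

/-- **`g ∈ G_Q(ℚ) ⟹ (g⁻¹)ᵀ ∈ G_{Q^∨}(ℚ)`** (the tree's `dualForm_comp_symm` with multiplier `1`). [cite: Moonen1999MTNotes, (1.8)] [cite: GreenGriffithsKerr2012, §I.A (PDF p. 34)] -/
theorem symm_dualMap_mem_isometryGroup_dual {g : V ≃ₗ[ℚ] V} (hg : g ∈ ψ.isometryGroup) : g.symm.dualMap ∈ ψ.dual.isometryGroup := by
  rw [Polarization.mem_isometryGroup_iff]
  intro φ χ
  rw [Polarization.dual_form]
  have h := ψ.dualForm_comp_symm g one_ne_zero (fun v w ↦ by rw [one_mul]; exact hg v w) φ χ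
  rw [inv_one, one_mul] at h
  exact h

/-- **`(g⁻¹)ᵀ ∈ G_{Q^∨}(ℚ) ⟹ g ∈ G_Q(ℚ)`**: then `(g⁻¹)† = θ⁻¹ (g⁻¹)ᵀ θ` is a `Q`-isometry, so `g⁻¹ (g⁻¹)† = 1`, `(g⁻¹)† = g`, `g† = g⁻¹`.
[cite: Moonen1999MTNotes, (1.8)] [cite: GreenGriffithsKerr2012, §I.A (PDF p. 34)] -/
theorem mem_isometryGroup_of_symm_dualMap_mem {g : V ≃ₗ[ℚ] V} (hg : g.symm.dualMap ∈ ψ.dual.isometryGroup) : g ∈ ψ.isometryGroup := by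
  set a : Module.End ℚ V := ψ.adjoint ((g⁻¹ : V ≃ₗ[ℚ] V) : Module.End ℚ V) with ha
  have hiso : ∀ v w, ψ.form (a v) (a w) = ψ.form v w := fun v w ↦ by
    rw [← dual_form_toDualEquiv ψ (a v) (a w), ha, toDualEquiv_adjoint_inv_apply, toDualEquiv_adjoint_inv_apply, hg,
      dual_form_toDualEquiv]
  have h1 : ψ.adjoint a * a = 1 := by
    refine LinearMap.ext fun w ↦ ?_
    rw [← sub_eq_zero, ← LinearMap.sub_apply]
    refine ψ.nondegenerate.2 _ fun v ↦ ?_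
    rw [LinearMap.sub_apply, map_sub, Module.End.mul_apply, ψ.form_apply_adjoint, hiso, Module.End.one_apply, sub_self]
  rw [ha, ψ.adjoint_adjoint] at h1
  have h2 : ψ.adjoint ((g⁻¹ : V ≃ₗ[ℚ] V) : Module.End ℚ V) = (g : Module.End ℚ V) := by
    have h3 := congrArg (fun x ↦ (g : Module.End ℚ V) * x) h1
    simp only [← mul_assoc, coe_mul_coe_inv₄₅, one_mul, mul_one] at h3
    exact h3
  rw [ψ.mem_isometryGroup_iff_adjoint_mul_self_eq_one]
  have h4 : ψ.adjoint (g : Module.End ℚ V) = ((g⁻¹ : V ≃ₗ[ℚ] V) : Module.End ℚ V) := by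
    rw [← h2, ψ.adjoint_adjoint]
  rw [h4]
  exact coe_inv_mul_coe₄₅ g

/-- **`G_{Q^∨}(ℚ) = G_Q(ℚ)ᶜ` elementwise: `(g⁻¹)ᵀ ∈ G_{Q^∨}(ℚ) ⟺ g ∈ G_Q(ℚ)`.** [cite: Moonen1999MTNotes, (1.8)] [cite: GreenGriffithsKerr2012, §I.A (PDF p. 34)] -/
theorem symm_dualMap_mem_isometryGroup_dual_iff (g : V ≃ₗ[ℚ] V) : g.symm.dualMap ∈ ψ.dual.isometryGroup ↔ g ∈ ψ.isometryGroup :=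
  ⟨mem_isometryGroup_of_symm_dualMap_mem ψ, symm_dualMap_mem_isometryGroup_dual ψ⟩

/-- **`G_{Q^∨}(ℚ)` is the image of `G_Q(ℚ)` under the contragredient.** [cite: Moonen1999MTNotes, (1.8)] [cite: GreenGriffithsKerr2012, §I.A (PDF p. 34)] -/
theorem isometryGroup_dual_eq : ψ.dual.isometryGroup = ψ.isometryGroup.map (contragredientOver (LinearEquiv.refl ℚ (Module.Dual ℚ V))) := by
  ext g'
  constructor
  · intro hg'
    obtain ⟨g, rfl⟩ := contragredientOver_surjective (LinearEquiv.refl ℚ (Module.Dual ℚ V)) g'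
    rw [contragredientOver_refl_apply] at hg'
    exact ⟨g, (symm_dualMap_mem_isometryGroup_dual_iff ψ g).1 hg', rfl⟩
  · rintro ⟨g, hg, rfl⟩
    rw [contragredientOver_refl_apply]
    exact (symm_dualMap_mem_isometryGroup_dual_iff ψ g).2 hg

/-- **`(g⁻¹)ᵀ ∈ Aut(H^∨, Q^∨, φ) ⟺ g ∈ Aut(H, Q, φ)`** — Hodge isometries correspond under the contragredient. [cite: Moonen1999MTNotes, (1.8)]
[cite: GreenGriffithsKerr2012, §I.A–§I.B (PDF pp. 34–35)] -/
theorem symm_dualMap_mem_polarizationAutGroup_dual_iff (g : V ≃ₗ[ℚ] V) : g.symm.dualMap ∈ ψ.dual.autGroup ↔ g ∈ ψ.autGroup := by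
  show g.symm.dualMap ∈ H.dual.autGroup ⊓ ψ.dual.isometryGroup ↔ g ∈ H.autGroup ⊓ ψ.isometryGroup
  rw [Subgroup.mem_inf, Subgroup.mem_inf, symm_dualMap_mem_autGroup_dual_iff, symm_dualMap_mem_isometryGroup_dual_iff]

/-- **`Aut(H^∨, Q^∨, φ)` is the image of `Aut(H, Q, φ)` under the contragredient.** [cite: Moonen1999MTNotes, (1.8)] [cite: GreenGriffithsKerr2012, §I.A–§I.B (PDF pp. 34–35)] -/
theorem polarizationAutGroup_dual_eq : ψ.dual.autGroup = ψ.autGroup.map (contragredientOver (LinearEquiv.refl ℚ (Module.Dual ℚ V))) := by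
  ext g'
  constructor
  · intro hg'
    obtain ⟨g, rfl⟩ := contragredientOver_surjective (LinearEquiv.refl ℚ (Module.Dual ℚ V)) g'
    rw [contragredientOver_refl_apply] at hg'
    exact ⟨g, (symm_dualMap_mem_polarizationAutGroup_dual_iff ψ g).1 hg', rfl⟩
  · rintro ⟨g, hg, rfl⟩
    rw [contragredientOver_refl_apply]
    exact (symm_dualMap_mem_polarizationAutGroup_dual_iff ψ g).2 hg

/-- The contragredient restricted to `Aut(H, Q, φ) →* Aut(H^∨, Q^∨, φ)`. [cite: Moonen1999MTNotes, (1.8)] -/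
def Polarization.autGroupContragredientHom : ψ.autGroup →* ψ.dual.autGroup where
  toFun g := ⟨contragredientOver (LinearEquiv.refl ℚ (Module.Dual ℚ V)) g.1, by
    rw [contragredientOver_refl_apply]
    exact (symm_dualMap_mem_polarizationAutGroup_dual_iff ψ g.1).2 g.2⟩
  map_one' := Subtype.ext (map_one _)
  map_mul' _ _ := Subtype.ext (map_mul _ _ _)

/-- `Aut(H, Q, φ) →* Aut(H^∨, Q^∨, φ)` is `g ↦ (g⁻¹)ᵀ`. [cite: Moonen1999MTNotes, (1.8)] -/
@[simp]
theorem Polarization.coe_autGroupContragredientHom_apply (g : ψ.autGroup) :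
    ((ψ.autGroupContragredientHom g : ψ.dual.autGroup) : Module.Dual ℚ V ≃ₗ[ℚ] Module.Dual ℚ V) = g.1.symm.dualMap :=
  contragredientOver_refl_apply g.1

/-- `Aut(H, Q, φ) →* Aut(H^∨, Q^∨, φ)` is bijective. [cite: Moonen1999MTNotes, (1.8)] -/
theorem Polarization.autGroupContragredientHom_bijective : Function.Bijective ψ.autGroupContragredientHom := by
  refine ⟨fun g g' h ↦ Subtype.ext (contragredientOver_refl_injective (congrArg Subtype.val h)), ?_⟩
  rintro ⟨g', hg'⟩
  obtain ⟨g, rfl⟩ := contragredientOver_surjective (LinearEquiv.refl ℚ (Module.Dual ℚ V)) g'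
  rw [contragredientOver_refl_apply] at hg'
  exact ⟨⟨g, (symm_dualMap_mem_polarizationAutGroup_dual_iff ψ g).1 hg'⟩, rfl⟩

/-- **`Aut(H, Q, φ) ≅ Aut(H^∨, Q^∨, φ)`, `g ↦ (g⁻¹)ᵀ`**, as a group isomorphism. [cite: Moonen1999MTNotes, (1.8)] [cite: GreenGriffithsKerr2012, §I.A–§I.B (PDF pp. 34–35)] -/
def Polarization.autGroupDualMulEquiv : ψ.autGroup ≃* ψ.dual.autGroup :=
  MulEquiv.ofBijective ψ.autGroupContragredientHom ψ.autGroupContragredientHom_bijective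

/-- `ψ.autGroupDualMulEquiv g = (g⁻¹)ᵀ`. [cite: Moonen1999MTNotes, (1.8)] -/
@[simp]
theorem Polarization.coe_autGroupDualMulEquiv_apply (g : ψ.autGroup) :
    ((ψ.autGroupDualMulEquiv g : ψ.dual.autGroup) : Module.Dual ℚ V ≃ₗ[ℚ] Module.Dual ℚ V) = g.1.symm.dualMap :=
  contragredientOver_refl_apply g.1

end Isometry

end HodgeStructure

end Literature.AlgebraicGeometry.Motives
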